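import Summits.CriticalPhenomena.Ising3DConformalLimit.Theorems.PrecisionLaplacianMoebiusLimitOfTwoPointLawDyadicReduction

/-!
# Line `SketchIdeator5R2` (card `inversion-buys-the-filter`) — skeleton v1 (lead a1, 2026-08-16)
# Crux stmt-CriticalPhenomena-4801 `PrecisionLaplacian.MoebiusLimitOfTwoPointLaw` (0634 → 1344)

Everything the card could prove is LANDED (no sorry outside the two stubs below):
* Lemma A  `tendstoLocallyUniformlyOn_nhdsGT_of_dyadic` / `…_of_geometricMesh` (p127591,
  Theorems/PrecisionLaplacianMoebiusLimitOfTwoPointLawMeshReparametrisation.lean): dyadic canonical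
  convergence + dilation covariance of the limit ⇒ convergence along the full filter `δ → 0⁺`.
* Lemma B  `inversionBegetsDilations` (p127660, …InversionBegetsDilations.lean): translations + unit
  inversion ⇒ every dilation (item 4675 gives `O(3)`).
* Reduction `moebiusLimitOfTwoPointLaw_iff_dyadic`, split `moebiusLimitOfTwoPointLaw_iff_dyadicLimit_and_dyadicInversion`
  and glue `moebiusLimitOfTwoPointLaw_of_dyadic : D₂ → I₂ → crux` (…DyadicReduction.lean).

So the crux is EXACTLY `D₂ ∧ I₂`, and the skeleton is the two stubs + one line of glue:
* `stub_dyadicLimit`     = D₂: for every witness `(Δ,c)` of the two-point law and every even `n ≥ 4`,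
  the canonically renormalised correlators `2^{knΔ}⟨σ_{[2^k x₁]}⋯σ_{[2^k xₙ]}⟩_{β_c}` converge locally
  uniformly off the diagonals as `k → ∞` (ONE mesh hierarchy; cf. items 4738 / 1981, of which this
  is the dyadic-canonical-even half).
* `stub_dyadicInversion` = I₂: every such dyadic limit `Tₙ` satisfies `Tₙ(ι x) = ∏‖xᵢ‖^{2Δ} Tₙ(x)` at
  non-coincident `x` off the origin (cf. item 1982; here `Tₙ` is known translation invariant,
  continuous, `×2`-covariant, `O_h`-invariant — NOT `O(3)`/scale covariant, those are OUTPUT).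
Both stubs are consequences of the crux (`dyadicLimit_of_…`, `dyadicInversion_of_…`), so the
decomposition loses nothing; both are open problems on `ℤ³` (Duminil-Copin ICM 2022 §8.4).
-/

noncomputable section

namespace Summit.CriticalPhenomena.Ising3DConformalLimit.Cruxes.MoebiusLimitOfTwoPointLaw.InversionBuysTheFilter

open Literature.Probability.LatticeModels Filter Topology EuclideanGeometry
open Summit.CriticalPhenomena.Ising3DConformalLimit.Theses.PrecisionLaplacian (MoebiusLimitOfTwoPointLaw)
open Summit.CriticalPhenomena.Ising3DConformalLimit.PrecisionLaplacianMoebiusLimitOfTwoPointLaw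
  (moebiusLimitOfTwoPointLaw_of_dyadic moebiusLimitOfTwoPointLaw_iff_dyadicLimit_and_dyadicInversion)

/-- **Stub D₂ (dyadic canonical existence, even arities `n ≥ 4`).** For every witness `(Δ, c)` of
item 0634 and every even `n ≥ 4` the canonically renormalised `n`-point correlators converge locally
uniformly on `NonCoincident 3 n` along the dyadic mesh sequence `δ_k = 2^{-k}`. OPEN (one-hierarchy
existence for the critical `ℤ³` correlators). -/
theorem stub_dyadicLimit :
    ∀ Δ c : ℝ, 0 < c →
      Tendsto (fun x : Site 3 =>
        criticalTwoPoint 3 x * Real.sqrt (∑ i, ((x i : ℝ)) ^ 2) ^ (2 * Δ)) cofinite (nhds c) →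
      ∀ n, 4 ≤ n → Even n → ∃ Tn : (Fin n → EuclideanSpace ℝ (Fin 3)) → ℝ,
        TendstoLocallyUniformlyOn
          (fun k : ℕ => rescaledCorrelator (criticalCorr 3) (fun δ => δ ^ (-Δ)) n (((2:ℝ) ^ k)⁻¹))
          Tn atTop (NonCoincident 3 n) := by
  sorry

/-- **Stub I₂ (unit-inversion covariance of dyadic limits).** For every witness `(Δ, c)` of item
0634, every even `n ≥ 4` and every dyadic canonical limit `Tₙ` of arity `n`,
`Tₙ (ι x) = (∏ᵢ ‖xᵢ‖^{2Δ}) Tₙ x` at non-coincident configurations off the origin. OPEN (inversion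
covariance of the critical `ℤ³` scaling limit, for a limit that is translation invariant,
continuous and `×2`-covariant but not known to be `O(3)` or scale covariant). -/
theorem stub_dyadicInversion :
    ∀ Δ c : ℝ, 0 < c →
      Tendsto (fun x : Site 3 =>
        criticalTwoPoint 3 x * Real.sqrt (∑ i, ((x i : ℝ)) ^ 2) ^ (2 * Δ)) cofinite (nhds c) →
      ∀ n, 4 ≤ n → Even n → ∀ Tn : (Fin n → EuclideanSpace ℝ (Fin 3)) → ℝ,
        TendstoLocallyUniformlyOn
          (fun k : ℕ => rescaledCorrelator (criticalCorr 3) (fun δ => δ ^ (-Δ)) n (((2:ℝ) ^ k)⁻¹))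
          Tn atTop (NonCoincident 3 n) →
        ∀ x ∈ NonCoincident 3 n, (∀ i, x i ≠ 0) →
          Tn (fun i => inversion 0 1 (x i)) = (∏ i, ‖x i‖ ^ (2 * Δ)) * Tn x := by
  sorry

/-- **Composition (glue only): the crux from the two stubs**, by the landed
`moebiusLimitOfTwoPointLaw_of_dyadic : D₂ → I₂ → crux`. The only `sorry`s in the closure are the two
stubs above. -/
theorem MoebiusLimitOfTwoPointLaw_of : MoebiusLimitOfTwoPointLaw :=
  moebiusLimitOfTwoPointLaw_of_dyadic stub_dyadicLimit stub_dyadicInversion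

/-- The same under the second host route's spelling (`Theses.BernsteinTemperature`, identical definiens). -/
theorem MoebiusLimitOfTwoPointLaw_of' :
    Summit.CriticalPhenomena.Ising3DConformalLimit.Theses.BernsteinTemperature.MoebiusLimitOfTwoPointLaw :=
  MoebiusLimitOfTwoPointLaw_of

/-- Exactness of the decomposition (landed): the crux is EQUIVALENT to the conjunction of the two
stubs' statements, so neither stub over-claims; the glue with the stubs as explicit hypotheses is the
landed `moebiusLimitOfTwoPointLaw_of_dyadic : D₂ → I₂ → crux`. -/
theorem crux_iff_stubs :
    MoebiusLimitOfTwoPointLaw ↔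
      ((∀ Δ c : ℝ, 0 < c →
        Tendsto (fun x : Site 3 =>
          criticalTwoPoint 3 x * Real.sqrt (∑ i, ((x i : ℝ)) ^ 2) ^ (2 * Δ)) cofinite (nhds c) →
        ∀ n, 4 ≤ n → Even n → ∃ Tn : (Fin n → EuclideanSpace ℝ (Fin 3)) → ℝ,
          TendstoLocallyUniformlyOn
            (fun k : ℕ => rescaledCorrelator (criticalCorr 3) (fun δ => δ ^ (-Δ)) n (((2:ℝ) ^ k)⁻¹))
            Tn atTop (NonCoincident 3 n)) ∧
      (∀ Δ c : ℝ, 0 < c →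
        Tendsto (fun x : Site 3 =>
          criticalTwoPoint 3 x * Real.sqrt (∑ i, ((x i : ℝ)) ^ 2) ^ (2 * Δ)) cofinite (nhds c) →
        ∀ n, 4 ≤ n → Even n → ∀ Tn : (Fin n → EuclideanSpace ℝ (Fin 3)) → ℝ,
          TendstoLocallyUniformlyOn
            (fun k : ℕ => rescaledCorrelator (criticalCorr 3) (fun δ => δ ^ (-Δ)) n (((2:ℝ) ^ k)⁻¹))
            Tn atTop (NonCoincident 3 n) →
          ∀ x ∈ NonCoincident 3 n, (∀ i, x i ≠ 0) →
            Tn (fun i => inversion 0 1 (x i)) = (∏ i, ‖x i‖ ^ (2 * Δ)) * Tn x)) :=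
  moebiusLimitOfTwoPointLaw_iff_dyadicLimit_and_dyadicInversion

end Summit.CriticalPhenomena.Ising3DConformalLimit.Cruxes.MoebiusLimitOfTwoPointLaw.InversionBuysTheFilter

end
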